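import Literature.IUT.HodgeArakelov.MonoThetaProjectiveBridgeEtThTower
import Literature.IUT.HodgeArakelov.MonoThetaProjectiveModelSystem
import Literature.IUT.HodgeArakelov.ModelCyclotomesZHat
import Literature.AnabelianGeometry.EtaleTheta.Discharge.Sec2Cor218ivAllLevels

/-!
# [IUTchII] Prop. 1.5 (i), (i)′ and (ii) for the genuine [EtTh] model family, modulo the FACT-LIST inputs of
# the [EtTh] Cor. 2.19 (ii) model discharge (proof-only capstone)

Proof-only companion (abc-iut cell; seat abc-iut-L2-t10, gen 3/4, layer L2 [EtTh]; DAG nodes **IUTchII:Prop1.5(i)**,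
**IUTchII:Prop1.5(ii)**, holder abc-iut-w4-d030; GAP-LEDGER G-w4d030-1) of abc-iut-w4-d030's
`MonoThetaProjectiveBridgeEtThTower.lean` (`EtaleLevels.prop15_i'_of_cyclotomeTower`) and
`MonoThetaProjectiveModelSystem.lean` (`EtaleLevels.transitionsAreIsos_modelSystem`,
`isMonoThetaCompatible_modelSystem`), in the shapes of abc-iut-w4-d038's `MonoThetaProjectiveNaturalSystemProofs.lean`
(`EtaleLevels.prop15_i_modelSystem`, `EtaleLevels.isTopCharacteristic_PiY_of_cor218_i` — re-derived inline here, one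
line each, so that this file does not wait on that module's build). NO definition, NO new named fact.

Sources: S. Mochizuki, *Inter-universal Teichmüller theory II*, kurims manuscript (Dec. 2020), Prop. 1.5 (i), (ii)
p. 29 [claim: Mochizuki2012, status: disputed] (IUTchII §1 Prop 1.5, kurims p.29): "(i) … Such a projective system
is uniquely determined, up to isomorphism, by `X̲̲_k` [cf. Remark 1.5.1 below; the discrete rigidity property of
[EtTh], Corollary 2.19, (ii)]. (ii) The transition morphisms of the resulting projective system of topological
groups … are all isomorphisms. Moreover, any isomorphism of topological groups `Π_X(M^Θ_{M'}) ⥲ Π_X(M^Θ_M)`,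
where `M` divides `M'`, lifts to a morphism of mono-theta environments `M^Θ_{M'} → M^Θ_M` [cf. [EtTh], Corollary
2.18, (iv)]."; S. Mochizuki, *The étale theta function …*, Publ. RIMS **45** (2009), Cor. 2.18 (i), (iv)
pp. 286–289 (PRIMS PDF pp. 60–63), Cor. 2.19 (ii), (iii) pp. 290–292 (PDF pp. 64–66)
[cite: MochizukiEtTh2009, Cor 2.18(iv) p.61].

WHAT IS PROVED. The three landed theorems take, BY NAME and at EVERY level `M ∈ ℕ≥1` (identification
`τ.modAll M` of abc-iut-w4-d024), the [EtTh] Cor. 2.18 (iv) level facts `ThetaEnvData.Cor218_iv_surjective`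
(FACT-LIST F-0639 / `RigidData` form F-0625, FACT-policy) and `ThetaEnvData.Cor218_iv_fibre` (F-0638; resp.
`RigidData.Prop214_i`, F-0631), and (`transitionsAreIsos_modelSystem`) the characteristicity `hchar` of
`Π^tp_Y̲̲ ⊆ Π^tp_X̲̲`. Layer L2 PROVES all of these for the §1 model at every `M ∈ ℕ≥1`
(`Discharge/Sec2Cor218ivAllLevels.lean`: `thetaEnvData_cor218_iv_surjective_modAll` ⟸ Cor. 2.18 (i) at the chain
levels + `ThetaEnvTower.Cor219_iii` + Prop. 1.5 (ii), (iii); `thetaEnvData_cor218_iv_fibre_of_origin` ⟸ Prop. 2.14 (i)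
for the model ⟸ `IsEtThOrigin`, `hYcl`; `hchar` ⟸ the `Π^tp_Y`-clause of Cor. 2.18 (i) at ANY one chain level,
the statement being level-free — cf. abc-iut-w4-d038's `isTopCharacteristic_PiY_of_cor218_i`). Substituting:
* `prop15_i'_of_cyclotomeTower_of_facts` — [IUTchII] Prop. 1.5 (i)′ over `ℕ≥1` for the model family of `X̲̲_K`,
  with binder list EXACTLY that of abc-iut-L2-d1's [EtTh] Cor. 2.19 (ii) model discharge
  `DoubleUnderline.cor219_ii_model_of_facts`: Prop. 1.5 (ii), (iii) (`h15ii`, `h15`), the cusp labels `L`,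
  temp-slimness of `Π^tp_X` (`hslimX`, [SemiAnbd] Ex. 3.10), openness of `Π^tp_X → G_K` (`haugOpen`), Cor. 2.18 (i)
  at every chain level (`h218i`, FACT-policy anabelian input), constant multiple rigidity in tower form
  (`h219iii` = `ThetaEnvTower.Cor219_iii`), and the §1 origin hypotheses `IsEtThOrigin`, `hYcl`;
* `transitionsAreIsos_modelSystem_of_facts` — [IUTchII] Prop. 1.5 (ii) for the natural system, modulo Prop. 1.5
  (ii), (iii), `L`, `hZ`, Cor. 2.18 (i) at the chain levels and `ThetaEnvTower.Cor219_iii` only; and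
  `transitionsAreIsos_modelSystem_of_origin` — the same with the system's input `hZ` ("`(l·Δ_Θ)(M) ≅ Ẑ`",
  GAP-LEDGER G-w4d021-1) supplied by abc-iut-L2-d1's THEOREM `ModelCyclotomes.nonempty_lDeltaQuot_rigidData_mulEquiv_zHat`
  (⟸ `IsEtThOrigin`, `hYcl`);
* `prop15_i_modelSystem_of_facts` (+ `_symm`) — [IUTchII] Prop. 1.5 (i) in the PRINTED form "uniquely determined,
  up to isomorphism, by `X̲̲_k`": every compatible projective system over the model family is isomorphic to the
  NATURAL system (`Prop15_i (modelSystem …) B`), modulo the same binder list plus `hZ`; and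
  `prop15_i_modelSystem_of_origin` — with `hZ` supplied as above, i.e. with the SAME binder list as
  `prop15_i'_of_cyclotomeTower_of_facts`;
* `prop15_modelSystem_of_origin` — (i) printed form ∧ (ii), one statement, one binder list.
So the [IUTchII] Prop. 1.5 (i)(ii) model discharges and the [EtTh] Cor. 2.19 (ii) model discharge now rest on
ONE AND THE SAME fact set; `Prop214_i`, `Cor218_iv_surjective`, `Cor218_iv_fibre` and `hchar` are no longer
assumed anywhere on this route.
HONEST FRAMING: conditional discharge modulo the inputs listed, which are NOT asserted; the [IUTchII] claim key
`Mochizuki2012` is DISPUTED (D-0012); no side is taken on [IUTchIII] Cor. 3.12; typed ≠ discharged.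
-/

noncomputable section

namespace Literature.IUT.HodgeArakelov

open Literature.AnabelianGeometry.EtaleTheta Literature.AnabelianGeometry.SemiGraphs
open scoped Literature.AnabelianGeometry.EtaleTheta

namespace EtaleLevels

variable {p : ℕ} [Fact p.Prime] {D : Literature.AnabelianGeometry.EtaleTheta.ThetaSetting p}
  {E : D.EtaleThetaData} {l : ℕ} (C : E.DoubleUnderline l) (hC : D.Compat) (hS : D.Sec2Hyps)
  (hl : l.Prime) (hp2 : p ≠ 2) (hpl : p ≠ l) (hζ : ∃ ζ : D.K, IsPrimitiveRoot ζ (4 * l))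
  {Es : Set ℕ+} (τ : D.CyclotomeTower l Es)
  (f : contCocycles D.toTheta D.DeltaTheta C.GtpYdduu) (hf : f ∈ C.rootCocycles hC)

/-! ## Prop. 1.5 (i)′ -/

/-- **[IUTchII] Prop. 1.5 (i)′ over `ℕ≥1` for the genuine [EtTh] model family, modulo the FACT-LIST inputs of the
[EtTh] Cor. 2.19 (ii) model discharge**: for the model family of `X̲̲_K` built from an [EtTh] §1 theta setting, a
choice `C` of `X̲̲`, ONE compatible cyclotome tower `τ` over any cofinal chain `E ∋ 1` (levels `τ.modAll M`,
`M ∈ ℕ≥1`) and one root cocycle, any two projective systems of mono-theta environments indexed by all of `ℕ≥1`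
whose transitions are morphisms of mono-theta environments are compatibly isomorphic — given Prop. 1.5 (ii), (iii)
of [EtTh] §1, the cusp labels, temp-slimness of `Π^tp_X`, openness of `Π^tp_X → G_K`, [EtTh] Cor. 2.18 (i) for the
instantiated rigidity data at every chain level, [EtTh] Cor. 2.19 (iii) in tower form (`ThetaEnvTower.Cor219_iii`),
and the §1 origin hypotheses `IsEtThOrigin` ("`Δ_X` profinite free on two generators", [EtTh] p. 12) and `hYcl`
("`(Δ^tp_Y)^Θ` … profinite", p. 12). The level facts Cor. 2.18 (iv) (surjectivity, fibres) consumed BY NAME by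
`prop15_i'_of_cyclotomeTower` are abc-iut-L2's THEOREMS `thetaEnvData_cor218_iv_surjective_modAll` /
`thetaEnvData_cor218_iv_fibre_of_origin`. [claim: Mochizuki2012, status: disputed] (IUTchII §1 Prop 1.5 (i), kurims p.29) -/
theorem prop15_i'_of_cyclotomeTower_of_facts
    (hslimX : Literature.AlgebraicGeometry.Frobenioids.IsSlimGroup D.PiTemp) (haugOpen : IsOpenMap D.aug)
    (h15 : Literature.AnabelianGeometry.EtaleTheta.ThetaSetting.Prop15iii E hC)
    (h15ii : Literature.AnabelianGeometry.EtaleTheta.ThetaSetting.Prop15ii E.toKummerData hC)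
    (L : C.CuspLabels)
    (h218i : ∀ e : Es, (C.rigidData (τ.mod e) hC hS h15 L).Cor218_i)
    (h219iii : (C.thetaEnvTower τ hC hS).Cor219_iii)
    (hO : D.IsEtThOrigin)
    (hYcl : (D.DtpY.map D.toHat.toMonoidHom).topologicalClosure ≤
      D.DtpY.map D.toHat.toMonoidHom ⊔ (⁅⁅D.DeltaHat, D.DeltaHat⁆, D.DeltaHat⁆).topologicalClosure)
    (A B : MonoThetaProjSystem (modelFamily C hC hS hl hp2 hpl hζ τ.modAll f hf)) :
    Literature.IUT.HodgeArakelov.Prop15_i'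
      (reductions C hC hS hl hp2 hpl hζ τ.modAll f hf τ.red_modAll hslimX) A B :=
  prop15_i'_of_cyclotomeTower C hC hS hl hp2 hpl hζ τ f hf hslimX haugOpen
    (fun M => C.thetaEnvData_cor218_iv_surjective_modAll τ M hC hS h15 h15ii L h218i h219iii)
    (fun M => C.thetaEnvData_cor218_iv_fibre_of_origin (τ.modAll M) hC hS h15 L hO hYcl) A B

/-! ## The characteristicity input `hchar`, from Cor. 2.18 (i) at any chain level -/

/-- **The hypothesis `hchar` of `transitionsAreIsos_modelSystem` from [EtTh] Cor. 2.18 (i) at ANY chain level**: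
Cor. 2.18 (i) for abc-iut-L2-t8's instantiated rigidity data is level-free (cf. `rigidData_cor218_i_of_level`),
and its FIRST CLAUSE (every topological automorphism of `Π^tp_X̲̲` carries `Π^tp_Y̲̲` onto itself) at any level
`e` of the chain `E` IS the topological characteristicity of `Π^tp_Y̲̲ ⊆ Π^tp_X̲̲` (`IsTopCharacteristic`;
same one-line reading as abc-iut-w4-d038's `isTopCharacteristic_PiY_of_cor218_i`, which is stated at the all-level
identifications `mods M`). [cite: MochizukiEtTh2009, Cor 2.18(i) p.60] -/
theorem isTopCharacteristic_PiY_of_cor218_i_chain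
    (h15 : Literature.AnabelianGeometry.EtaleTheta.ThetaSetting.Prop15iii E hC) (L : C.CuspLabels)
    (e : Es) (h218i : (C.rigidData (τ.mod e) hC hS h15 L).Cor218_i) :
    Literature.AnabelianGeometry.EtaleTheta.IsTopCharacteristic ↥C.Huu (D.GtpY.subgroupOf C.Huu) :=
  fun φ => (h218i φ).1

/-! ## Prop. 1.5 (ii) for the natural system -/

/-- **[IUTchII] Prop. 1.5 (ii) for the natural system of `X̲̲_K`, modulo the FACT-LIST inputs**: abc-iut-w4-d030's
`transitionsAreIsos_modelSystem` with BOTH its by-name hypotheses supplied by layer L2 — `hchar` from the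
`Π^tp_Y`-clause of [EtTh] Cor. 2.18 (i) (chain level `1`), `hsurj` = [EtTh] Cor. 2.18 (iv) surjectivity at EVERY
`M ∈ ℕ≥1` from Cor. 2.18 (i) at the chain levels + `ThetaEnvTower.Cor219_iii` + Prop. 1.5 (ii), (iii)
(`thetaEnvData_cor218_iv_surjective_modAll`). Remaining inputs of the system itself: Prop. 1.5 (iii), the cusp
labels `L`, and `hZ` ("`(l·Δ_Θ)(M) ≅ Ẑ`", GAP-LEDGER G-w4d021-1).
[claim: Mochizuki2012, status: disputed] (IUTchII §1 Prop 1.5 (ii), kurims p.29) -/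
theorem transitionsAreIsos_modelSystem_of_facts
    (h15 : Literature.AnabelianGeometry.EtaleTheta.ThetaSetting.Prop15iii E hC)
    (h15ii : Literature.AnabelianGeometry.EtaleTheta.ThetaSetting.Prop15ii E.toKummerData hC)
    (L : C.CuspLabels)
    (hZ : ∀ M : ℕ+, Nonempty (ModelCyclotomes.lDeltaQuot (C.rigidData (τ.modAll M) hC hS h15 L) ≃*
      Literature.IUT.HodgeTheaters.ZHat))
    (h218i : ∀ e : Es, (C.rigidData (τ.mod e) hC hS h15 L).Cor218_i)
    (h219iii : (C.thetaEnvTower τ hC hS).Cor219_iii) :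
    (modelSystem C hC hS hl hp2 hpl hζ τ.modAll f hf τ.red_modAll h15 L hZ).transitionsAreIsos :=
  transitionsAreIsos_modelSystem C hC hS hl hp2 hpl hζ τ.modAll f hf τ.red_modAll h15 L hZ
    (isTopCharacteristic_PiY_of_cor218_i_chain C hC hS τ h15 L ⟨1, τ.one_mem⟩ (h218i ⟨1, τ.one_mem⟩))
    (fun M => C.thetaEnvData_cor218_iv_surjective_modAll τ M hC hS h15 h15ii L h218i h219iii)

/-- **[IUTchII] Prop. 1.5 (ii) for the natural system of `X̲̲_K`, origin form**: as
`transitionsAreIsos_modelSystem_of_facts`, with the system's input `hZ` ("`(l·Δ_Θ)(M) ≅ Ẑ`", [EtTh] p. 12;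
GAP-LEDGER G-w4d021-1) supplied at every level by abc-iut-L2-d1's THEOREM
`ModelCyclotomes.nonempty_lDeltaQuot_rigidData_mulEquiv_zHat` (⟸ `IsEtThOrigin`, `hYcl`) — so the binder list is
that of `prop15_i'_of_cyclotomeTower_of_facts` (less `hslimX`, `haugOpen`): Prop. 1.5 (ii), (iii), `L`, Cor. 2.18
(i) at the chain levels, `ThetaEnvTower.Cor219_iii`, `IsEtThOrigin`, `hYcl`.
[claim: Mochizuki2012, status: disputed] (IUTchII §1 Prop 1.5 (ii), kurims p.29) -/
theorem transitionsAreIsos_modelSystem_of_origin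
    (h15 : Literature.AnabelianGeometry.EtaleTheta.ThetaSetting.Prop15iii E hC)
    (h15ii : Literature.AnabelianGeometry.EtaleTheta.ThetaSetting.Prop15ii E.toKummerData hC)
    (L : C.CuspLabels)
    (h218i : ∀ e : Es, (C.rigidData (τ.mod e) hC hS h15 L).Cor218_i)
    (h219iii : (C.thetaEnvTower τ hC hS).Cor219_iii) (hO : D.IsEtThOrigin)
    (hYcl : (D.DtpY.map D.toHat.toMonoidHom).topologicalClosure ≤
      D.DtpY.map D.toHat.toMonoidHom ⊔ (⁅⁅D.DeltaHat, D.DeltaHat⁆, D.DeltaHat⁆).topologicalClosure) :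
    (modelSystem C hC hS hl hp2 hpl hζ τ.modAll f hf τ.red_modAll h15 L (fun M =>
      ModelCyclotomes.nonempty_lDeltaQuot_rigidData_mulEquiv_zHat C (τ.modAll M) hC hS h15 L hO hYcl
        hl.ne_zero)).transitionsAreIsos :=
  transitionsAreIsos_modelSystem_of_facts C hC hS hl hp2 hpl hζ τ f hf h15 h15ii L _ h218i h219iii

/-! ## Prop. 1.5 (i) as printed: every compatible system is isomorphic to the natural one -/

/-- **[IUTchII] Prop. 1.5 (i) in the PRINTED form, modulo the FACT-LIST inputs** ("Such a projective system is
uniquely determined, up to isomorphism, by `X̲̲_k` [cf. … the discrete rigidity property of [EtTh], Corollary 2.19,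
(ii)]"): for every projective system `B` of mono-theta environments over the model family of `X̲̲_K` whose
transitions are morphisms of mono-theta environments (`IsMonoThetaCompatible`), the NATURAL system `modelSystem`
and `B` are isomorphic as projective systems (`Prop15_i`) — abc-iut-w4-d030's `prop15_i'_etaleLevels` at the
pair `(modelSystem, B)`, the left member qualifying by `isMonoThetaCompatible_modelSystem` (the shape of
abc-iut-w4-d038's `prop15_i_modelSystem`), with its level-wise [EtTh] Cor. 2.18 (iv) inputs `hsurj`, `hfibre`
supplied by abc-iut-L2's THEOREMS
`thetaEnvData_cor218_iv_surjective_modAll` (⟸ Cor. 2.18 (i) at the chain levels, `ThetaEnvTower.Cor219_iii`,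
Prop. 1.5 (ii), (iii)) and `thetaEnvData_cor218_iv_fibre_of_origin` (⟸ `IsEtThOrigin`, `hYcl`). Residual inputs:
Prop. 1.5 (ii), (iii), `L`, `hZ`, temp-slimness of `Π^tp_X`, `IsOpenMap D.aug`, Cor. 2.18 (i) at the chain levels,
`ThetaEnvTower.Cor219_iii`, `IsEtThOrigin`, `hYcl`. [claim: Mochizuki2012, status: disputed] (IUTchII §1 Prop 1.5 (i), kurims p.29)
[cite: MochizukiEtTh2009, Cor 2.19(ii) p.64] -/
theorem prop15_i_modelSystem_of_facts
    (hslimX : Literature.AlgebraicGeometry.Frobenioids.IsSlimGroup D.PiTemp) (haugOpen : IsOpenMap D.aug)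
    (h15 : Literature.AnabelianGeometry.EtaleTheta.ThetaSetting.Prop15iii E hC)
    (h15ii : Literature.AnabelianGeometry.EtaleTheta.ThetaSetting.Prop15ii E.toKummerData hC)
    (L : C.CuspLabels)
    (hZ : ∀ M : ℕ+, Nonempty (ModelCyclotomes.lDeltaQuot (C.rigidData (τ.modAll M) hC hS h15 L) ≃*
      Literature.IUT.HodgeTheaters.ZHat))
    (h218i : ∀ e : Es, (C.rigidData (τ.mod e) hC hS h15 L).Cor218_i)
    (h219iii : (C.thetaEnvTower τ hC hS).Cor219_iii) (hO : D.IsEtThOrigin)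
    (hYcl : (D.DtpY.map D.toHat.toMonoidHom).topologicalClosure ≤
      D.DtpY.map D.toHat.toMonoidHom ⊔ (⁅⁅D.DeltaHat, D.DeltaHat⁆, D.DeltaHat⁆).topologicalClosure)
    (B : MonoThetaProjSystem (modelFamily C hC hS hl hp2 hpl hζ τ.modAll f hf))
    (hB : B.IsMonoThetaCompatible (reductions C hC hS hl hp2 hpl hζ τ.modAll f hf τ.red_modAll hslimX)) :
    Prop15_i (modelSystem C hC hS hl hp2 hpl hζ τ.modAll f hf τ.red_modAll h15 L hZ) B :=
  prop15_i'_etaleLevels C hC hS hl hp2 hpl hζ τ.modAll f hf τ.red_modAll hslimX haugOpen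
    (fun M => C.thetaEnvData_cor218_iv_surjective_modAll τ M hC hS h15 h15ii L h218i h219iii)
    (fun M => C.thetaEnvData_cor218_iv_fibre_of_origin (τ.modAll M) hC hS h15 L hO hYcl) _ B
    (isMonoThetaCompatible_modelSystem C hC hS hl hp2 hpl hζ τ.modAll f hf τ.red_modAll h15 L hZ hslimX) hB

/-- `prop15_i_modelSystem_of_facts` with the natural system on the RIGHT (`Prop15_i B (modelSystem …)`; the shape
of abc-iut-w4-d038's `prop15_i_modelSystem_symm`).
[claim: Mochizuki2012, status: disputed] (IUTchII §1 Prop 1.5 (i), kurims p.29) [cite: MochizukiEtTh2009, Cor 2.19(ii) p.64] -/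
theorem prop15_i_modelSystem_of_facts_symm
    (hslimX : Literature.AlgebraicGeometry.Frobenioids.IsSlimGroup D.PiTemp) (haugOpen : IsOpenMap D.aug)
    (h15 : Literature.AnabelianGeometry.EtaleTheta.ThetaSetting.Prop15iii E hC)
    (h15ii : Literature.AnabelianGeometry.EtaleTheta.ThetaSetting.Prop15ii E.toKummerData hC)
    (L : C.CuspLabels)
    (hZ : ∀ M : ℕ+, Nonempty (ModelCyclotomes.lDeltaQuot (C.rigidData (τ.modAll M) hC hS h15 L) ≃*
      Literature.IUT.HodgeTheaters.ZHat))
    (h218i : ∀ e : Es, (C.rigidData (τ.mod e) hC hS h15 L).Cor218_i)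
    (h219iii : (C.thetaEnvTower τ hC hS).Cor219_iii) (hO : D.IsEtThOrigin)
    (hYcl : (D.DtpY.map D.toHat.toMonoidHom).topologicalClosure ≤
      D.DtpY.map D.toHat.toMonoidHom ⊔ (⁅⁅D.DeltaHat, D.DeltaHat⁆, D.DeltaHat⁆).topologicalClosure)
    (B : MonoThetaProjSystem (modelFamily C hC hS hl hp2 hpl hζ τ.modAll f hf))
    (hB : B.IsMonoThetaCompatible (reductions C hC hS hl hp2 hpl hζ τ.modAll f hf τ.red_modAll hslimX)) :
    Prop15_i B (modelSystem C hC hS hl hp2 hpl hζ τ.modAll f hf τ.red_modAll h15 L hZ) :=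
  prop15_i'_etaleLevels C hC hS hl hp2 hpl hζ τ.modAll f hf τ.red_modAll hslimX haugOpen
    (fun M => C.thetaEnvData_cor218_iv_surjective_modAll τ M hC hS h15 h15ii L h218i h219iii)
    (fun M => C.thetaEnvData_cor218_iv_fibre_of_origin (τ.modAll M) hC hS h15 L hO hYcl) B _ hB
    (isMonoThetaCompatible_modelSystem C hC hS hl hp2 hpl hζ τ.modAll f hf τ.red_modAll h15 L hZ hslimX)

/-- **[IUTchII] Prop. 1.5 (i) in the PRINTED form, origin form**: as `prop15_i_modelSystem_of_facts`, with the
system's input `hZ` supplied at every level by abc-iut-L2-d1's THEOREM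
`ModelCyclotomes.nonempty_lDeltaQuot_rigidData_mulEquiv_zHat` (⟸ `IsEtThOrigin`, `hYcl`) — binder list EXACTLY
that of `prop15_i'_of_cyclotomeTower_of_facts`. [claim: Mochizuki2012, status: disputed] (IUTchII §1 Prop 1.5 (i), kurims p.29)
[cite: MochizukiEtTh2009, Cor 2.19(ii) p.64] -/
theorem prop15_i_modelSystem_of_origin
    (hslimX : Literature.AlgebraicGeometry.Frobenioids.IsSlimGroup D.PiTemp) (haugOpen : IsOpenMap D.aug)
    (h15 : Literature.AnabelianGeometry.EtaleTheta.ThetaSetting.Prop15iii E hC)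
    (h15ii : Literature.AnabelianGeometry.EtaleTheta.ThetaSetting.Prop15ii E.toKummerData hC)
    (L : C.CuspLabels)
    (h218i : ∀ e : Es, (C.rigidData (τ.mod e) hC hS h15 L).Cor218_i)
    (h219iii : (C.thetaEnvTower τ hC hS).Cor219_iii) (hO : D.IsEtThOrigin)
    (hYcl : (D.DtpY.map D.toHat.toMonoidHom).topologicalClosure ≤
      D.DtpY.map D.toHat.toMonoidHom ⊔ (⁅⁅D.DeltaHat, D.DeltaHat⁆, D.DeltaHat⁆).topologicalClosure)
    (B : MonoThetaProjSystem (modelFamily C hC hS hl hp2 hpl hζ τ.modAll f hf))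
    (hB : B.IsMonoThetaCompatible (reductions C hC hS hl hp2 hpl hζ τ.modAll f hf τ.red_modAll hslimX)) :
    Prop15_i (modelSystem C hC hS hl hp2 hpl hζ τ.modAll f hf τ.red_modAll h15 L (fun M =>
      ModelCyclotomes.nonempty_lDeltaQuot_rigidData_mulEquiv_zHat C (τ.modAll M) hC hS h15 L hO hYcl
        hl.ne_zero)) B :=
  prop15_i_modelSystem_of_facts C hC hS hl hp2 hpl hζ τ f hf hslimX haugOpen h15 h15ii L _ h218i h219iii hO
    hYcl B hB

/-! ## Summary: Prop. 1.5 (i) (printed form) and (ii) at the natural system, one binder list -/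

/-- **[IUTchII] Prop. 1.5 (i) (printed form) ∧ (ii) for the NATURAL projective system of model mono-theta
environments of `X̲̲_K` over `ℕ≥1`**, modulo ONE binder list = the FACT-LIST inputs of abc-iut-L2-d1's [EtTh]
Cor. 2.19 (ii) model discharge: Prop. 1.5 (ii), (iii) of [EtTh] §1, the cusp labels `L`, temp-slimness of
`Π^tp_X`, `IsOpenMap D.aug`, [EtTh] Cor. 2.18 (i) at every chain level, `ThetaEnvTower.Cor219_iii`, and the §1
origin hypotheses `IsEtThOrigin`, `hYcl`. First conjunct: the transitions of the natural system induce
isomorphisms on `Π_X(–)` and every such isomorphism lifts (Prop. 1.5 (ii)); second: every compatible system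
over the model family is isomorphic to the natural one (Prop. 1.5 (i) as printed).
[claim: Mochizuki2012, status: disputed] (IUTchII §1 Prop 1.5, kurims p.29) [cite: MochizukiEtTh2009, Cor 2.19(ii) p.64] -/
theorem prop15_modelSystem_of_origin
    (hslimX : Literature.AlgebraicGeometry.Frobenioids.IsSlimGroup D.PiTemp) (haugOpen : IsOpenMap D.aug)
    (h15 : Literature.AnabelianGeometry.EtaleTheta.ThetaSetting.Prop15iii E hC)
    (h15ii : Literature.AnabelianGeometry.EtaleTheta.ThetaSetting.Prop15ii E.toKummerData hC)
    (L : C.CuspLabels)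
    (h218i : ∀ e : Es, (C.rigidData (τ.mod e) hC hS h15 L).Cor218_i)
    (h219iii : (C.thetaEnvTower τ hC hS).Cor219_iii) (hO : D.IsEtThOrigin)
    (hYcl : (D.DtpY.map D.toHat.toMonoidHom).topologicalClosure ≤
      D.DtpY.map D.toHat.toMonoidHom ⊔ (⁅⁅D.DeltaHat, D.DeltaHat⁆, D.DeltaHat⁆).topologicalClosure) :
    (modelSystem C hC hS hl hp2 hpl hζ τ.modAll f hf τ.red_modAll h15 L (fun M =>
      ModelCyclotomes.nonempty_lDeltaQuot_rigidData_mulEquiv_zHat C (τ.modAll M) hC hS h15 L hO hYcl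
        hl.ne_zero)).transitionsAreIsos ∧
    ∀ (B : MonoThetaProjSystem (modelFamily C hC hS hl hp2 hpl hζ τ.modAll f hf)),
      B.IsMonoThetaCompatible (reductions C hC hS hl hp2 hpl hζ τ.modAll f hf τ.red_modAll hslimX) →
      Prop15_i (modelSystem C hC hS hl hp2 hpl hζ τ.modAll f hf τ.red_modAll h15 L (fun M =>
        ModelCyclotomes.nonempty_lDeltaQuot_rigidData_mulEquiv_zHat C (τ.modAll M) hC hS h15 L hO hYcl
          hl.ne_zero)) B :=
  ⟨transitionsAreIsos_modelSystem_of_origin C hC hS hl hp2 hpl hζ τ f hf h15 h15ii L h218i h219iii hO hYcl,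
    fun B hB => prop15_i_modelSystem_of_origin C hC hS hl hp2 hpl hζ τ f hf hslimX haugOpen h15 h15ii L h218i
      h219iii hO hYcl B hB⟩

end EtaleLevels

end Literature.IUT.HodgeArakelov

end
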